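import Literature.AlgebraicGeometry.Milne1999.SpecialLefschetzGroupInvariantsSingleGenerator
import Literature.AlgebraicGeometry.VanGeemen1994.WeilTypeHodgeRingOfSU
import Literature.AlgebraicGeometry.HodgeTheory.WeilPlaneFibreCharts
import Literature.AlgebraicGeometry.HodgeTheory.WeilTypeHodgeRing
import Mathlib.LinearAlgebra.Eigenspace.Minpoly
import Mathlib.RingTheory.RootsOfUnity.Complex
import Mathlib.FieldTheory.IsAlgClosed.Basic
import HarnessLib

/-!
# The Hodge ring of an abelian variety of Weil type whose Hodge group contains the determinant-one part
# `S(A)(ℂ) ∩ SU_K` of Milne's unitary centraliser group: divisor classes and the Weil plane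
# (the type-IV general members with `End⁰(A) = E ⊋ K`, `K` acting with multiplicities `(n,n)`)

Family `hodge`, layer `Literature/AlgebraicGeometry/HodgeTheory`, namespace
`Literature.AlgebraicGeometry.HodgeTheory` (helpers in the sub-namespace `WeilDetOne`). THEOREMS ONLY (no
definition, no named fact, no `sorry`; the torus elements and the adapted basis are produced by existence lemmas).
Written for the cell `pub-hodgeav-hg6` (req-37 (A) Q2b, TABLE X rows 11 `g6.IV(2,1).kE0` and 13 `g6.IV(3,1).kE0`:
simple sixfolds with `End⁰ = E` a CM field STRICTLY containing an imaginary quadratic `K = ℚ(√-d)` that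
acts with multiplicities `(3,3)`), as the «⟨D, W_K⟩ socket» asked for by the cell's inventory
(`INVENTORY-g5-ADDENDUM.md` §3 (2)). HONEST FRAMING: nothing here proves HC / HC_AV / HC_CM; the hypothesis
«`Hg(A) ⊇ S(A)(ℂ) ∩ SU_K`» (the GENERAL member) is displayed, never discharged.

## The statement

Let `A` be a complex abelian variety of dimension `2n`, `φ : A ⟶ A` with `φ ≫ φ = -d` (`d ≥ 1`), `W = ker(φ^* - i√d)`,
`W̄ = ker(φ^* + i√d)` (`H¹(A(ℂ); ℂ) = W ⊕ W̄`), and let `h ∈ H²(A(ℂ); ℂ)` be a rational class with a Kähler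
multiple, with polarization pairing `Q_h(x, y) = h^{dim A - 1} ⌣ x ⌣ y`. Milne's `S(A)(ℂ) = unitaryCentralizerGroup A h`
is the group of automorphisms of `H¹` commuting with every `ψ^*`, `ψ ∈ End(A)`, and preserving `Q_h`
(`Milne1999/LefschetzCentraliser`). Suppose

* `φ^*` is a `d`-similitude of `Q_h`: `Q_h(φ^*x, φ^*y) = d · Q_h(x, y)` (the Rosati involution is complex
  conjugation on `K`);
* Milne's single-generator data for `C(A) ⊗ ℂ` (`Milne1999/SpecialLefschetzGroupInvariantsSingleGenerator`):
  `C(A) ⊗ ℂ` is the commutant of ONE diagonalisable `φ_E^*` whose `Q_h`-adjoint `J'` commutes with `C(A) ⊗ ℂ`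
  (type IV with `End⁰(A) = E = ℚ(φ_E)` a CM field, `J' = φ̄_E^*`); then every `ψ^*` — in particular `φ^*` — is
  central in `C(A) ⊗ ℂ`;
* **the general member**: every `u ∈ S(A)(ℂ)` with `det(u | W) = 1` lies in the degree-one Hodge group
  `hodgeGroupOne A.dim A.X` (`Hg(A) ⊇ S(A) ∩ SU_K = U_E ∩ SU_K`; for `E = K` this is van Geemen's `Hg = SU_H`).

Then **`IsDivisorWeilGenerated A φ n d`**: `Bᵖ ⊗ ℂ ⊆ Dᵖ ⊗ ℂ` for `p ≠ n` and `Bⁿ ⊗ ℂ ⊆ Dⁿ ⊗ ℂ + W_K ⊗ ℂ`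
(`isDivisorWeilGenerated_of_hodgeGroup_ge_unitaryCentralizer_detOne`). For `n = 3` this is TABLE X's
«`B• = D• ⊕ W_k`, `exc = (0,0,2,0,0)`» on rows 11 / 13 (cell computation J1, ×2), now a theorem under the
displayed group hypothesis.

## Proof (Milne's Lefschetz theorem + the `K`-torus)

1. The `K`-TORUS `t_c = c` on `W`, `c⁻¹` on `W̄` (`WeilDetOne.exists_kTorus`) lies in `S(A)(ℂ)`: it commutes with
   every `ψ^*` because `φ^*` does, and it preserves `Q_h` because `W`, `W̄` are `Q_h`-isotropic
   (`Q_h(φ^*x, φ^*y) = d Q_h(x,y)` and `(±i√d)² = -d`); `det(t_c | W) = c^{2n}`. Hence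
   `S(A)(ℂ) = T · (S(A)(ℂ) ∩ SU_K)` (`ℂ` is algebraically closed: `c^{2n} = det(u|W)` is solvable).
2. In a basis of `H¹` made of a basis of `W` followed by a basis of `W̄` (`WeilDetOne.exists_kBasis`; monomial basis
   `VanGeemen1994.monB` of `H^q = ⋀^q H¹`), `⋀^q t_c` multiplies the monomial `b_s` by `c^{a(s)} c^{-b(s)}`
   (`a`, `b` = number of `W`-, `W̄`-letters). The root of unity `t_ζ`, `ζ = e^{2πi/2n}`, has `det = 1`, so it FIXES
   every Hodge class `x` (hypothesis): the coordinates of `x` live on the BALANCED monomials (`a = b`) and on the two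
   TOPS `⋀^{2n}W`, `⋀^{2n}W̄` (`2n ∣ a - b`, `a, b ≤ 2n`).
3. The balanced part `x₀ = P(⋀^q t₂) x` (`P` the Lagrange idempotent of the eigenvalue `1`) is fixed by
   `S(A)(ℂ) ∩ SU_K` (which commutes with `t₂`) and by `T`, hence by all of `S(A)(ℂ)`; by MILNE
   (`Milne1999.mem_divisorClassesSpan_of_forall_exteriorPullback_eq_of_adjoint`, Thm. 3.2 / Cor. 4.5 for one
   generator with a Rosati partner) `x₀ ∈ Dᵖ ⊗ ℂ`.
4. The tops are Weil classes: `⋀^{2n}W ⊆ E₊`, `⋀^{2n}W̄ ⊆ E₋` (`cupPowOne_mem_weilClassesPlus/Minus`), so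
   `x - x₀ ∈ W_K ⊗ ℂ` (and `x = x₀` off the middle degree).

Sources. B. van Geemen, LNM 1594 (1994), 6.9–6.12 and proof of Thm. 6.12 (`V_ℂ = W ⊕ W^*`, the invariants
`∧^{2n}W`, `∧^{2n}W^*`; the case `E = K`) [cite: vanGeemen1994HodgeAV, Thm. 6.12]; J. S. Milne, *Lefschetz classes on
abelian varieties*, Duke Math. J. 96 (1999), §1–§2 (`C(A)`, `S(A)`, type IV), Thm. 3.2, Cor. 4.5
[cite: Milne1999LefschetzClasses, Thm. 3.2 and Cor. 4.5]; B. Moonen, Yu. Zarhin, *Weil classes on abelian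
varieties*, Crelle 496 (1998), §1 (Criterion; «`Hdg(X) ⊂ Gl_F(V_X)` acts on `W_F` through `det_F`»)
[cite: MoonenZarhin1998WeilClasses, §1]; B. Moonen, Yu. Zarhin, Math. Ann. 315 (1999), (1.9), (2.3)
[cite: MoonenZarhin1999LowDim, (1.9) and (2.3)]. NOT here: the positivity facts «Rosati = complex conjugation on
`E`», «`Hg` of the general member IS `U_E ∩ SU_K`» (displayed hypotheses), and anything about the algebraicity
of `W_K`.
-/

noncomputable section

open CategoryTheory Polynomial
open Literature.AlgebraicTopology.SingularHomology
open Literature.AlgebraicGeometry.Motives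
open Literature.AlgebraicGeometry.VanGeemen1994
open Literature.AlgebraicGeometry.Milne1999
open Literature.Barriers.HodgeConjecture (divisorClassesSpan)

namespace Literature.AlgebraicGeometry.HodgeTheory

namespace WeilDetOne

variable {A : AbelianVariety ℂ} {φ : A ⟶ A} {n d : ℕ}
variable (hd : 0 < d) (hφ : φ ≫ φ = -(d • 𝟙 A))

/-! ### §1 The `K`-torus `t_c = c|_W ⊕ c⁻¹|_{W̄}` -/

include hd hφ in
/-- **The `K`-torus element `t_c` exists**: an automorphism of `H¹(A(ℂ); ℂ) = W ⊕ W̄` (`W = ker(φ^* - i√d)`,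
`W̄ = ker(φ^* + i√d)`, `φ ≫ φ = -d`) which is `c` on `W` and `c⁻¹` on `W̄` — the `ℂ`-points of the torus
`K^× ∩ U_K` acting on `V_ℂ = W ⊕ W^*` ("the one dimensional `GL(2n, ℂ)` representations", van Geemen, proof of
6.12; Milne's centre of `C(A)` for `K ⊂` centre of `End⁰(A)`). [cite: vanGeemen1994HodgeAV, 6.9–6.10 and proof of Thm. 6.12]
[cite: Milne1999LefschetzClasses, §2 p. 646] -/
theorem exists_kTorus (c : ℂˣ) : ∃ t : complexBetti A.X 1 ≃ₗ[ℂ] complexBetti A.X 1,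
    (∀ x ∈ eigW A φ d, t x = (c : ℂ) • x) ∧ ∀ y ∈ eigWbar A φ d, t y = ((c⁻¹ : ℂˣ) : ℂ) • y := by
  set e := Submodule.prodEquivOfIsCompl _ _ (isCompl_eigenspace_eigenspace_neg hd hφ) with he
  refine ⟨e.symm ≪≫ₗ (((LinearEquiv.smulOfUnit c).prodCongr (LinearEquiv.smulOfUnit c⁻¹)) ≪≫ₗ e),
    fun x hx ↦ ?_, fun y hy ↦ ?_⟩
  · have h1 : x = ((⟨x, hx⟩ : eigW A φ d) : complexBetti A.X 1) := rfl
    rw [LinearEquiv.trans_apply, LinearEquiv.trans_apply, h1, he, Submodule.prodEquivOfIsCompl_symm_apply_left,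
      LinearEquiv.prodCongr_apply, Submodule.coe_prodEquivOfIsCompl']
    simp [LinearEquiv.smulOfUnit, Units.smul_def]
  · have h1 : y = ((⟨y, hy⟩ : eigWbar A φ d) : complexBetti A.X 1) := rfl
    rw [LinearEquiv.trans_apply, LinearEquiv.trans_apply, h1, he, Submodule.prodEquivOfIsCompl_symm_apply_right,
      LinearEquiv.prodCongr_apply, Submodule.coe_prodEquivOfIsCompl']
    simp [LinearEquiv.smulOfUnit, Units.smul_def]

include hd hφ in
/-- Every class of `H¹` is `x + y` with `x ∈ W`, `y ∈ W̄`. [cite: vanGeemen1994HodgeAV, proof of Lemma 5.2] -/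
theorem exists_add_of_isCompl (v : complexBetti A.X 1) :
    ∃ x ∈ eigW A φ d, ∃ y ∈ eigWbar A φ d, v = x + y := by
  have hv : v ∈ eigW A φ d ⊔ eigWbar A φ d := by
    rw [(isCompl_eigenspace_eigenspace_neg hd hφ).sup_eq_top]; exact Submodule.mem_top
  obtain ⟨x, hx, y, hy, hxy⟩ := Submodule.mem_sup.1 hv
  exact ⟨x, hx, y, hy, hxy.symm⟩

variable {c : ℂˣ} {t : complexBetti A.X 1 ≃ₗ[ℂ] complexBetti A.X 1}
  (ht : ∀ x ∈ eigW A φ d, t x = (c : ℂ) • x) (ht' : ∀ y ∈ eigWbar A φ d, t y = ((c⁻¹ : ℂˣ) : ℂ) • y)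

include ht ht' in
/-- `t_c (x + y) = c x + c⁻¹ y` for `x ∈ W`, `y ∈ W̄`. [cite: vanGeemen1994HodgeAV, proof of Thm. 6.12] -/
theorem kTorus_apply_add {x y : complexBetti A.X 1} (hx : x ∈ eigW A φ d) (hy : y ∈ eigWbar A φ d) :
    t (x + y) = (c : ℂ) • x + ((c⁻¹ : ℂˣ) : ℂ) • y := by
  rw [map_add, ht x hx, ht' y hy]

include hd hφ ht ht' in
/-- **`t_c` commutes with every linear map commuting with `φ^*`** (such a map preserves `W` and `W̄`).
[cite: vanGeemen1994HodgeAV, Lemma 6.10 (proof)] -/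
theorem kTorus_comm_of_comm {g : complexBetti A.X 1 →ₗ[ℂ] complexBetti A.X 1}
    (hg : ∀ x, g (pullbackOne A φ x) = pullbackOne A φ (g x)) (v : complexBetti A.X 1) :
    g (t v) = t (g v) := by
  obtain ⟨x, hx, y, hy, rfl⟩ := exists_add_of_isCompl hd hφ v
  have hgx : g x ∈ eigW A φ d := by
    rw [Module.End.mem_eigenspace_iff] at hx ⊢
    rw [← hg, hx, map_smul]
  have hgy : g y ∈ eigWbar A φ d := by
    rw [Module.End.mem_eigenspace_iff] at hy ⊢
    rw [← hg, hy, map_smul]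
  rw [kTorus_apply_add ht ht' hx hy, map_add, map_smul, map_smul, map_add, kTorus_apply_add ht ht' hgx hgy]

include hd hφ ht ht' in
/-- `t_c` commutes with `φ^*`. [cite: vanGeemen1994HodgeAV, Lemma 6.10] -/
theorem kTorus_comm_pullbackOne (x : complexBetti A.X 1) : t (pullbackOne A φ x) = pullbackOne A φ (t x) :=
  (kTorus_comm_of_comm hd hφ ht ht' (g := pullbackOne A φ) (fun _ ↦ rfl) x).symm

include hd hφ ht ht' in
/-- `t_c ∘ t_{c⁻¹} = 1`. [folklore] -/
private theorem kTorus_mul_kTorus_inv {t' : complexBetti A.X 1 ≃ₗ[ℂ] complexBetti A.X 1}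
    (ht'₁ : ∀ x ∈ eigW A φ d, t' x = ((c⁻¹ : ℂˣ) : ℂ) • x)
    (ht'₂ : ∀ y ∈ eigWbar A φ d, t' y = ((c⁻¹⁻¹ : ℂˣ) : ℂ) • y) : t * t' = 1 := by
  refine LinearEquiv.ext fun v ↦ ?_
  obtain ⟨x, hx, y, hy, rfl⟩ := exists_add_of_isCompl hd hφ v
  rw [LinearEquiv.mul_apply, kTorus_apply_add ht'₁ ht'₂ hx hy,
    kTorus_apply_add ht ht' (Submodule.smul_mem _ _ hx) (Submodule.smul_mem _ _ hy), smul_smul, smul_smul,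
    inv_inv, Units.inv_mul, Units.mul_inv, one_smul, one_smul]
  rfl

variable {h : complexBetti A.X 2}

include hd in
/-- **`W` and `W̄` are `Q_h`-isotropic** when `φ^*` is a `d`-similitude of `Q_h` (`Q_h(φ^*x, φ^*y) = d Q_h(x,y)`:
on an eigenspace of eigenvalue `ε` with `ε² = -d` this reads `-d Q = d Q`). [cite: vanGeemen1994HodgeAV, Lemma 5.2 (2)] -/
theorem polarizationPairingOne_eq_zero_of_mem_eigenspace
    (hφQ : ∀ x y, polarizationPairingOne A.X h (A.dim - 1) (pullbackOne A φ x) (pullbackOne A φ y) =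
      (d : ℂ) • polarizationPairingOne A.X h (A.dim - 1) x y)
    {ε : ℂ} (hε : ε ^ 2 = -(d : ℂ)) {x y : complexBetti A.X 1}
    (hx : x ∈ Module.End.eigenspace (pullbackOne A φ) ε) (hy : y ∈ Module.End.eigenspace (pullbackOne A φ) ε) :
    polarizationPairingOne A.X h (A.dim - 1) x y = 0 := by
  rw [Module.End.mem_eigenspace_iff] at hx hy
  have e := hφQ x y
  rw [hx, hy, LinearMap.map_smul₂, map_smul, smul_smul, ← sq, hε] at e
  have e' : ((d : ℂ) + d) • polarizationPairingOne A.X h (A.dim - 1) x y = 0 := by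
    rw [add_smul]
    nth_rewrite 1 [← e]
    rw [neg_smul, neg_add_cancel]
  have hd' : ((d : ℂ) + d) ≠ 0 := by
    rw [← two_mul]; exact mul_ne_zero two_ne_zero (Nat.cast_ne_zero.2 hd.ne')
  exact (smul_eq_zero.1 e').resolve_left hd'

include hd hφ ht ht' in
/-- **`t_c` preserves `Q_h`** (`W`, `W̄` isotropic; `Q_h(cx, c⁻¹y) = Q_h(x, y)`). [cite: vanGeemen1994HodgeAV, 6.9 and proof of Thm. 6.12] -/
theorem polarizationPairingOne_kTorus
    (hφQ : ∀ x y, polarizationPairingOne A.X h (A.dim - 1) (pullbackOne A φ x) (pullbackOne A φ y) =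
      (d : ℂ) • polarizationPairingOne A.X h (A.dim - 1) x y)
    (v w : complexBetti A.X 1) :
    polarizationPairingOne A.X h (A.dim - 1) (t v) (t w) = polarizationPairingOne A.X h (A.dim - 1) v w := by
  set Q := polarizationPairingOne A.X h (A.dim - 1) with hQ
  obtain ⟨x, hx, y, hy, rfl⟩ := exists_add_of_isCompl hd hφ v
  obtain ⟨x', hx', y', hy', rfl⟩ := exists_add_of_isCompl hd hφ w
  have hμ2 : (Complex.I * (Real.sqrt d : ℂ)) ^ 2 = -(d : ℂ) := I_mul_sqrt_sq d
  have hμ2' : (-(Complex.I * (Real.sqrt d : ℂ))) ^ 2 = -(d : ℂ) := by rw [neg_sq, I_mul_sqrt_sq]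
  have h0 : Q x x' = 0 := polarizationPairingOne_eq_zero_of_mem_eigenspace hd hφQ hμ2 hx hx'
  have h0' : Q y y' = 0 := polarizationPairingOne_eq_zero_of_mem_eigenspace hd hφQ hμ2' hy hy'
  rw [kTorus_apply_add ht ht' hx hy, kTorus_apply_add ht ht' hx' hy']
  simp only [map_add, LinearMap.add_apply, map_smul, LinearMap.smul_apply, h0, h0', smul_zero, zero_add, add_zero,
    smul_smul, Units.inv_mul, Units.mul_inv, one_smul]

include hd hφ ht ht' in
/-- **`t_c ∈ S(A)(ℂ)`** (Milne's `unitaryCentralizerGroup A h`): it commutes with every `ψ^*`, `ψ ∈ End(A)`, because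
`φ^*` is central (`φ^* ∈ C(A) ⊗ ℂ`), and it preserves `Q_h`. [cite: Milne1999LefschetzClasses, §1 p. 644 and §2 p. 646] -/
theorem kTorus_mem_unitaryCentralizerGroup (hφC : pullbackOne A φ ∈ centralizerAlgebra A)
    (hφQ : ∀ x y, polarizationPairingOne A.X h (A.dim - 1) (pullbackOne A φ x) (pullbackOne A φ y) =
      (d : ℂ) • polarizationPairingOne A.X h (A.dim - 1) x y) :
    t ∈ unitaryCentralizerGroup A h := by
  refine ⟨mem_centralizerGroup_iff.2 fun ψ v ↦ ?_, polarizationPairingOne_kTorus hd hφ ht ht' hφQ⟩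
  have hcomm := (mem_centralizerAlgebra_iff'.1 hφC) ψ
  exact (kTorus_comm_of_comm hd hφ ht ht' (g := pullbackOne A ψ) (fun x ↦ (hcomm x).symm) v).symm

include hd hφ ht in
/-- **`det(t_c | W) = c^{2n}`** (`dim W = 2n` for `dim A = 2n`). [cite: vanGeemen1994HodgeAV, Lemma 6.10] -/
theorem detOnEigenspace_kTorus (hA : A.dim = 2 * n) (hc : ∀ x, t (pullbackOne A φ x) = pullbackOne A φ (t x)) :
    detOnEigenspace t (pullbackOne A φ) hc (Complex.I * (Real.sqrt d : ℂ)) = (c : ℂ) ^ (2 * n) := by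
  haveI := finite_complexBetti_abelianVariety A 1
  unfold detOnEigenspace
  have hres : ((t : complexBetti A.X 1 ≃ₗ[ℂ] complexBetti A.X 1) : complexBetti A.X 1 →ₗ[ℂ] complexBetti A.X 1).restrict
        (mapsTo_eigenspace_of_comm hc (Complex.I * (Real.sqrt d : ℂ))) = (c : ℂ) • LinearMap.id := by
    ext x
    rw [LinearMap.coe_restrict_apply, LinearEquiv.coe_coe, ht _ x.2, LinearMap.smul_apply, LinearMap.id_apply,
      Submodule.coe_smul]
  rw [hres, LinearMap.det_smul, LinearMap.det_id, mul_one, finrank_eigW hd hφ hA]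

/-! ### §2 A basis of `H¹` adapted to `W ⊕ W̄` and the weights of the torus on the monomials -/

include hd hφ in
/-- **A `K`-adapted basis of `H¹(A(ℂ); ℂ)` exists**: a basis of `W` (indices `castAdd`) followed by a basis of `W̄`
(indices `natAdd`), `dim W = dim W̄ = 2n`. [cite: vanGeemen1994HodgeAV, Lemma 6.10 and proof of Thm. 6.12] -/
theorem exists_kBasis (hA : A.dim = 2 * n) : ∃ b : Module.Basis (Fin (2 * n + 2 * n)) ℂ (complexBetti A.X 1),
    (∀ i, b (Fin.castAdd (2 * n) i) ∈ eigW A φ d) ∧ ∀ j, b (Fin.natAdd (2 * n) j) ∈ eigWbar A φ d := by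
  haveI := finite_complexBetti_abelianVariety A 1
  set b := (((Module.finBasisOfFinrankEq ℂ (eigW A φ d) (finrank_eigW hd hφ hA)).prod
    (Module.finBasisOfFinrankEq ℂ (eigWbar A φ d)
      ((finrank_eigenspace_eq_finrank_eigenspace_neg hd hφ).symm.trans (finrank_eigW hd hφ hA)))).map
    (Submodule.prodEquivOfIsCompl _ _ (isCompl_eigenspace_eigenspace_neg hd hφ))).reindex finSumFinEquiv with hb
  refine ⟨b, fun i ↦ ?_, fun j ↦ ?_⟩
  · rw [hb, Module.Basis.reindex_apply, finSumFinEquiv_symm_apply_castAdd, Module.Basis.map_apply,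
      Module.Basis.prod_apply, Sum.elim_inl, Function.comp_apply, LinearMap.inl_apply,
      Submodule.coe_prodEquivOfIsCompl', Submodule.coe_zero, add_zero]
    exact Submodule.coe_mem _
  · rw [hb, Module.Basis.reindex_apply, finSumFinEquiv_symm_apply_natAdd, Module.Basis.map_apply,
      Module.Basis.prod_apply, Sum.elim_inr, Function.comp_apply, LinearMap.inr_apply,
      Submodule.coe_prodEquivOfIsCompl', Submodule.coe_zero, zero_add]
    exact Submodule.coe_mem _

variable {b : Module.Basis (Fin (2 * n + 2 * n)) ℂ (complexBetti A.X 1)}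
  (hb₁ : ∀ i, b (Fin.castAdd (2 * n) i) ∈ eigW A φ d) (hb₂ : ∀ j, b (Fin.natAdd (2 * n) j) ∈ eigWbar A φ d)

include ht ht' hb₁ hb₂ in
/-- `t_c` is diagonal in the adapted basis: weight `c` on the `W`-indices (`< 2n`), `c⁻¹` on the `W̄`-indices.
[cite: vanGeemen1994HodgeAV, proof of Thm. 6.12] -/
theorem kTorus_kBasis (j : Fin (2 * n + 2 * n)) :
    t (b j) = (if j.val < 2 * n then (c : ℂ) else ((c⁻¹ : ℂˣ) : ℂ)) • b j := by
  refine Fin.addCases (fun i ↦ ?_) (fun i ↦ ?_) j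
  · rw [ht _ (hb₁ i), if_pos]
    simp
  · rw [ht' _ (hb₂ i), if_neg]
    simp

/-- `a(s) + b(s) = |s|` for the numbers of `W`- and `W̄`-letters of an index set. [folklore] -/
private theorem card_filter_lt_add (s : Finset (Fin (2 * n + 2 * n))) :
    (s.filter fun j ↦ j.val < 2 * n).card + (s.filter fun j ↦ ¬ j.val < 2 * n).card = s.card :=
  Finset.card_filter_add_card_filter_not _

/-- `a(s) ≤ 2n` (the `W`-letters are among the `2n` indices `< 2n`). [folklore] -/
private theorem card_filter_lt_le (s : Finset (Fin (2 * n + 2 * n))) : (s.filter fun j ↦ j.val < 2 * n).card ≤ 2 * n := by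
  classical
  calc (s.filter fun j ↦ j.val < 2 * n).card
      ≤ ((Finset.univ : Finset (Fin (2 * n + 2 * n))).filter fun j ↦ j.val < 2 * n).card :=
        Finset.card_le_card (Finset.filter_subset_filter _ (Finset.subset_univ _))
    _ = (Finset.univ.map (Fin.castAddEmb (2 * n) : Fin (2 * n) ↪ Fin (2 * n + 2 * n))).card := by
        congr 1
        ext j
        simp only [Finset.mem_filter, Finset.mem_univ, true_and, Finset.mem_map, Fin.castAddEmb_apply]
        constructor
        · intro hj; exact ⟨⟨j, hj⟩, Fin.ext rfl⟩
        · rintro ⟨i, rfl⟩; exact i.2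
    _ = 2 * n := by rw [Finset.card_map, Finset.card_univ, Fintype.card_fin]

/-- `b(s) ≤ 2n`. [folklore] -/
private theorem card_filter_not_lt_le (s : Finset (Fin (2 * n + 2 * n))) :
    (s.filter fun j ↦ ¬ j.val < 2 * n).card ≤ 2 * n := by
  classical
  calc (s.filter fun j ↦ ¬ j.val < 2 * n).card
      ≤ ((Finset.univ : Finset (Fin (2 * n + 2 * n))).filter fun j ↦ ¬ j.val < 2 * n).card :=
        Finset.card_le_card (Finset.filter_subset_filter _ (Finset.subset_univ _))
    _ = (Finset.univ.map (Fin.natAddEmb (2 * n) : Fin (2 * n) ↪ Fin (2 * n + 2 * n))).card := by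
        congr 1
        ext j
        simp only [Finset.mem_filter, Finset.mem_univ, true_and, Finset.mem_map, Fin.natAddEmb_apply, not_lt]
        constructor
        · intro hj
          refine ⟨⟨j - 2 * n, by omega⟩, Fin.ext ?_⟩
          simp only [Fin.val_natAdd]; omega
        · rintro ⟨i, rfl⟩; simp
    _ = 2 * n := by rw [Finset.card_map, Finset.card_univ, Fintype.card_fin]

/-- The torus weight of an index set: `∏_{j ∈ s} wt_c(j) = c^{a(s)} · c^{-b(s)}`. [cite: vanGeemen1994HodgeAV, proof of Thm. 6.12] -/
theorem prod_kWt (c : ℂˣ) (s : Finset (Fin (2 * n + 2 * n))) :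
    ∏ j ∈ s, (if j.val < 2 * n then (c : ℂ) else ((c⁻¹ : ℂˣ) : ℂ)) =
      (c : ℂ) ^ (s.filter fun j ↦ j.val < 2 * n).card * ((c⁻¹ : ℂˣ) : ℂ) ^ (s.filter fun j ↦ ¬ j.val < 2 * n).card := by
  classical
  rw [← Finset.prod_filter_mul_prod_filter_not s (fun j ↦ j.val < 2 * n)]
  congr 1
  · rw [Finset.prod_congr rfl (fun j hj ↦ by rw [if_pos (Finset.mem_filter.1 hj).2]), Finset.prod_const]
  · rw [Finset.prod_congr rfl (fun j hj ↦ by rw [if_neg (Finset.mem_filter.1 hj).2]), Finset.prod_const]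

include ht ht' hb₁ hb₂ in
/-- **The torus acts diagonally on the monomial basis**: `⋀^q t_c (b_s) = c^{a(s)} c^{-b(s)} · b_s`.
[cite: vanGeemen1994HodgeAV, proof of Thm. 6.12] -/
theorem extAct_kTorus_monB (q : ℕ) (s : Set.powersetCard (Fin (2 * n + 2 * n)) q) :
    extAct (t : complexBetti A.X 1 →ₗ[ℂ] complexBetti A.X 1) q (monB b q s) =
      ((c : ℂ) ^ (s.val.filter fun j ↦ j.val < 2 * n).card *
        ((c⁻¹ : ℂˣ) : ℂ) ^ (s.val.filter fun j ↦ ¬ j.val < 2 * n).card) • monB b q s := by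
  rw [← prod_kWt]
  exact extAct_monB_of_diagonal _ _ _ (fun j ↦ by rw [LinearEquiv.coe_coe, kTorus_kBasis ht ht' hb₁ hb₂]) q s

include ht ht' hb₁ hb₂ in
/-- Coordinates under the diagonal action: `(⋀^q t_c x)_s = c^{a(s)} c^{-b(s)} x_s`. [folklore] -/
private theorem repr_extAct_kTorus (q : ℕ) (x : complexBetti A.X q) (s : Set.powersetCard (Fin (2 * n + 2 * n)) q) :
    (monB b q).repr (extAct (t : complexBetti A.X 1 →ₗ[ℂ] complexBetti A.X 1) q x) s =
      ((c : ℂ) ^ (s.val.filter fun j ↦ j.val < 2 * n).card *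
        ((c⁻¹ : ℂˣ) : ℂ) ^ (s.val.filter fun j ↦ ¬ j.val < 2 * n).card) * (monB b q).repr x s := by
  classical
  set B := monB b q with hB
  conv_lhs => rw [← B.sum_repr x, map_sum]
  simp_rw [map_smul, hB, extAct_kTorus_monB ht ht' hb₁ hb₂ q, smul_smul, map_sum, map_smul, Module.Basis.repr_self,
    Finsupp.smul_single, smul_eq_mul, mul_one]
  rw [Finset.sum_apply', Finset.sum_eq_single s]
  · rw [Finsupp.single_eq_same, mul_comm]
  · intro u _ hu; rw [Finsupp.single_eq_of_ne (Ne.symm hu)]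
  · intro hs; exact absurd (Finset.mem_univ s) hs

/-! ### §3 Functoriality of the exterior action and the eigenvalue-one projector of `⋀^q t₂` -/

/-- `⋀^q (u ∘ v) = ⋀^q u ∘ ⋀^q v`. [cite: vanGeemen1994HodgeAV, 6.5] -/
theorem extAct_comp (u v : complexBetti A.X 1 →ₗ[ℂ] complexBetti A.X 1) (q : ℕ) :
    extAct (u ∘ₗ v) q = extAct u q ∘ₗ extAct v q := by
  refine exteriorPullback_ext (hasExteriorCohomologyH1 A) fun w ↦ ?_
  rw [LinearMap.comp_apply]
  change extAct (u ∘ₗ v) q _ = extAct u q (extAct v q _)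
  rw [extAct_cupPowOne, extAct_cupPowOne, extAct_cupPowOne]
  rfl

/-- If `a` commutes with `b` then `a` commutes with every polynomial in `b`. [folklore] -/
private theorem commute_aeval_of_commute {R S : Type*} [CommSemiring R] [Semiring S] [Algebra R S] {a b : S}
    (hab : Commute a b) (p : R[X]) : Commute a (aeval b p) := by
  refine p.induction_on (fun r ↦ ?_) (fun p q hp hq ↦ ?_) (fun m r h ↦ ?_)
  · rw [aeval_C]; exact (Algebra.commute_algebraMap_left r a).symm
  · rw [map_add]; exact hp.add_right hq
  · rw [pow_succ, ← mul_assoc, map_mul, aeval_X]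
    exact h.mul_right hab

/-- The weight `2^{a} · 2^{-b}` is `1` iff `a = b`. [folklore] -/
private theorem two_pow_mul_inv_pow_eq_one_iff (a b : ℕ) :
    ((Units.mk0 (2 : ℂ) two_ne_zero : ℂˣ) : ℂ) ^ a * (((Units.mk0 (2 : ℂ) two_ne_zero)⁻¹ : ℂˣ) : ℂ) ^ b = 1 ↔
      a = b := by
  rw [Units.val_inv_eq_inv_val, Units.val_mk0, inv_pow, mul_inv_eq_one₀ (pow_ne_zero _ two_ne_zero)]
  constructor
  · intro h
    have h' : ((2 ^ a : ℕ) : ℂ) = ((2 ^ b : ℕ) : ℂ) := by push_cast; exact h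
    exact Nat.pow_right_injective (le_refl 2) (Nat.cast_injective h')
  · intro h; rw [h]

include ht ht' hb₁ hb₂ in
/-- **The eigenvalue-one idempotent of `⋀^q t₂` as a polynomial** (Lagrange; here `c = 2`): there is a
polynomial `P` with `P(⋀^q t₂) b_s = b_s` for balanced `s` (`a(s) = b(s)`) and `= 0` otherwise. [folklore] -/
private theorem exists_balancedProjector (hc2 : c = Units.mk0 (2 : ℂ) two_ne_zero) (q : ℕ) :
    ∃ P : ℂ[X], ∀ s : Set.powersetCard (Fin (2 * n + 2 * n)) q,
      aeval (extAct (t : complexBetti A.X 1 →ₗ[ℂ] complexBetti A.X 1) q) P (monB b q s) =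
        if (s.val.filter fun j ↦ j.val < 2 * n).card = (s.val.filter fun j ↦ ¬ j.val < 2 * n).card
        then monB b q s else 0 := by
  classical
  subst hc2
  set wt : Set.powersetCard (Fin (2 * n + 2 * n)) q → ℂ := fun s ↦
    ((Units.mk0 (2 : ℂ) two_ne_zero : ℂˣ) : ℂ) ^ (s.val.filter fun j ↦ j.val < 2 * n).card *
      (((Units.mk0 (2 : ℂ) two_ne_zero)⁻¹ : ℂˣ) : ℂ) ^ (s.val.filter fun j ↦ ¬ j.val < 2 * n).card with hwt
  set T := (Finset.univ.image wt).erase 1 with hT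
  refine ⟨∏ v ∈ T, (C (1 - v)⁻¹ * (X - C v)), fun s ↦ ?_⟩
  have hev : extAct (t : complexBetti A.X 1 →ₗ[ℂ] complexBetti A.X 1) q (monB b q s) = wt s • monB b q s :=
    extAct_kTorus_monB ht ht' hb₁ hb₂ q s
  rw [Module.End.aeval_apply_of_mem_apply_eq_smul hev, eval_prod]
  simp only [eval_mul, eval_C, eval_sub, eval_X]
  by_cases hs : (s.val.filter fun j ↦ j.val < 2 * n).card = (s.val.filter fun j ↦ ¬ j.val < 2 * n).card
  · rw [if_pos hs]
    have h1 : wt s = 1 := (two_pow_mul_inv_pow_eq_one_iff _ _).2 hs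
    rw [h1, Finset.prod_eq_one fun v hv ↦ ?_, one_smul]
    have hv1 : v ≠ 1 := (Finset.mem_erase.1 hv).1
    exact inv_mul_cancel₀ (sub_ne_zero.2 hv1.symm)
  · rw [if_neg hs]
    have h1 : wt s ≠ 1 := fun h ↦ hs ((two_pow_mul_inv_pow_eq_one_iff _ _).1 h)
    have hmem : wt s ∈ T := Finset.mem_erase.2 ⟨h1, Finset.mem_image_of_mem _ (Finset.mem_univ s)⟩
    rw [Finset.prod_eq_zero hmem (by rw [sub_self, mul_zero]), zero_smul]

/-! ### §4 The support of a class fixed by `t_ζ`, `ζ^{2n} = 1`: balanced monomials and the two tops -/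

include ht ht' hb₁ hb₂ in
/-- **A class fixed by `⋀^q t_ζ` for a primitive `2n`-th root of unity `ζ` has coordinates only on the BALANCED
index sets and on the two TOP index sets** (`a(s) = 2n, b(s) = 0` or `a(s) = 0, b(s) = 2n`): the weight
`ζ^{a(s) - b(s)}` must be `1`, and `a(s), b(s) ≤ 2n`. [cite: vanGeemen1994HodgeAV, proof of Thm. 6.12] -/
theorem balanced_or_top_of_repr_ne_zero (hζ : IsPrimitiveRoot (c : ℂ) (2 * n)) {q : ℕ} {x : complexBetti A.X q}
    (hx : extAct (t : complexBetti A.X 1 →ₗ[ℂ] complexBetti A.X 1) q x = x)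
    {s : Set.powersetCard (Fin (2 * n + 2 * n)) q} (hs : (monB b q).repr x s ≠ 0) :
    (s.val.filter fun j ↦ j.val < 2 * n).card = (s.val.filter fun j ↦ ¬ j.val < 2 * n).card ∨
      ((s.val.filter fun j ↦ j.val < 2 * n).card = 2 * n ∧ (s.val.filter fun j ↦ ¬ j.val < 2 * n).card = 0) ∨
      ((s.val.filter fun j ↦ j.val < 2 * n).card = 0 ∧ (s.val.filter fun j ↦ ¬ j.val < 2 * n).card = 2 * n) := by
  set α := (s.val.filter fun j ↦ j.val < 2 * n).card with hα
  set β := (s.val.filter fun j ↦ ¬ j.val < 2 * n).card with hβ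
  have h := repr_extAct_kTorus ht ht' hb₁ hb₂ q x s
  rw [hx] at h
  have hw : (c : ℂ) ^ α * ((c⁻¹ : ℂˣ) : ℂ) ^ β = 1 := by
    have h' : ((c : ℂ) ^ α * ((c⁻¹ : ℂˣ) : ℂ) ^ β - 1) * (monB b q).repr x s = 0 := by
      rw [sub_mul, one_mul, ← h, sub_self]
    exact sub_eq_zero.1 ((mul_eq_zero.1 h').resolve_right hs)
  have hζ0 : (c : ℂ) ≠ 0 := Units.ne_zero c
  -- `ζ^a = ζ^b`
  have hab : (c : ℂ) ^ α = (c : ℂ) ^ β := by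
    rw [Units.val_inv_eq_inv_val, inv_pow] at hw
    rwa [mul_inv_eq_one₀ (pow_ne_zero _ hζ0)] at hw
  have ha : α ≤ 2 * n := card_filter_lt_le s.val
  have hb : β ≤ 2 * n := card_filter_not_lt_le s.val
  rcases Nat.lt_or_ge α (2 * n) with ha' | ha'
  · rcases Nat.lt_or_ge β (2 * n) with hb' | hb'
    · exact Or.inl (hζ.pow_inj ha' hb' hab)
    · have hb2 : β = 2 * n := le_antisymm hb hb'
      rw [hb2, hζ.pow_eq_one, hζ.pow_eq_one_iff_dvd] at hab
      exact Or.inr (Or.inr ⟨Nat.eq_zero_of_dvd_of_lt hab ha', hb2⟩)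
  · have ha2 : α = 2 * n := le_antisymm ha ha'
    rw [ha2, hζ.pow_eq_one, eq_comm, hζ.pow_eq_one_iff_dvd] at hab
    rcases Nat.lt_or_ge β (2 * n) with hb' | hb'
    · exact Or.inr (Or.inl ⟨ha2, Nat.eq_zero_of_dvd_of_lt hab hb'⟩)
    · exact Or.inl (ha2.trans (le_antisymm hb hb').symm)

/-- A top-plus index set (`b(s) = 0`) consists of `W`-indices only. [folklore] -/
private theorem forall_lt_of_top (s : Finset (Fin (2 * n + 2 * n))) (hb : (s.filter fun j ↦ ¬ j.val < 2 * n).card = 0) :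
    ∀ j ∈ s, j.val < 2 * n := by
  classical
  intro j hj
  by_contra hj'
  have : j ∈ s.filter fun j ↦ ¬ j.val < 2 * n := Finset.mem_filter.2 ⟨hj, hj'⟩
  rw [Finset.card_eq_zero] at hb
  rw [hb] at this
  exact absurd this (Finset.notMem_empty j)

/-- A top-minus index set (`a(s) = 0`) consists of `W̄`-indices only. [folklore] -/
private theorem forall_le_of_top (s : Finset (Fin (2 * n + 2 * n))) (ha : (s.filter fun j ↦ j.val < 2 * n).card = 0) :
    ∀ j ∈ s, ¬ j.val < 2 * n := by
  classical
  intro j hj hj'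
  have : j ∈ s.filter fun j ↦ j.val < 2 * n := Finset.mem_filter.2 ⟨hj, hj'⟩
  rw [Finset.card_eq_zero] at ha
  rw [ha] at this
  exact absurd this (Finset.notMem_empty j)

include hb₁ in
/-- **The top monomials are Weil classes**: if every index of `s` is a `W`-index then `b_s ∈ E₊ = ⋀^{2n}W`
(degree `2n`). [cite: vanGeemen1994HodgeAV, 4.9 and proof of Thm. 6.12] [cite: MoonenZarhin1999LowDim, (1.9)] -/
theorem monB_mem_weilClassesPlus (s : Set.powersetCard (Fin (2 * n + 2 * n)) (2 * n))
    (hs : ∀ j ∈ s.val, j.val < 2 * n) : monB b (2 * n) s ∈ weilClassesPlus A φ n d := by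
  rw [monB_apply]
  refine cupPowOne_mem_weilClassesPlus fun r ↦ ?_
  set j := Finset.orderEmbOfFin s.val s.prop r with hj
  have hjs : j ∈ s.val := Finset.orderEmbOfFin_mem _ _ r
  have hjlt := hs j hjs
  have hjeq : j = Fin.castAdd (2 * n) ⟨j, hjlt⟩ := Fin.ext rfl
  rw [hjeq]
  exact hb₁ _

include hb₂ in
/-- Likewise `b_s ∈ E₋ = ⋀^{2n}W̄` when every index of `s` is a `W̄`-index. [cite: vanGeemen1994HodgeAV, 4.9 and proof of Thm. 6.12] -/
theorem monB_mem_weilClassesMinus (s : Set.powersetCard (Fin (2 * n + 2 * n)) (2 * n))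
    (hs : ∀ j ∈ s.val, ¬ j.val < 2 * n) : monB b (2 * n) s ∈ weilClassesMinus A φ n d := by
  rw [monB_apply]
  refine cupPowOne_mem_weilClassesMinus fun r ↦ ?_
  set j := Finset.orderEmbOfFin s.val s.prop r with hj
  have hjs : j ∈ s.val := Finset.orderEmbOfFin_mem _ _ r
  have hjge := hs j hjs
  have hjlt : (j : ℕ) - 2 * n < 2 * n := by have := j.2; omega
  have hjeq : j = Fin.natAdd (2 * n) ⟨(j : ℕ) - 2 * n, hjlt⟩ := Fin.ext (by simp only [Fin.val_natAdd]; omega)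
  rw [hjeq]
  exact hb₂ _

/-- If `C(A) ⊗ ℂ` is the commutant of one `φ_E^*`, every pull-back `ψ^*` lies in `C(A) ⊗ ℂ` (it commutes with
`C(A) ⊗ ℂ ∋ φ_E^*`, Milne's Remark 1.2) — the tree's
`Milne1999.pullbackOne_mem_centralizerAlgebra_of_centralizerAlgebra_eq_centralizer_singleton`
(`Milne1999/LefschetzCentraliserOneGenerator`), re-proved here in five lines to keep the import list short.
[cite: Milne1999LefschetzClasses, §1 p. 642 and Remark 1.2 (p. 643)] -/
theorem pullbackOne_mem_centralizerAlgebra_of_singleton (φE : A ⟶ A)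
    (hC : centralizerAlgebra A = Subalgebra.centralizer ℂ {pullbackOne A φE}) (ψ : A ⟶ A) :
    pullbackOne A ψ ∈ centralizerAlgebra A := by
  have hφE : pullbackOne A φE ∈ centralizerAlgebra A := by
    rw [hC, Subalgebra.mem_centralizer_iff]
    intro g hg
    rw [Set.mem_singleton_iff.1 hg]
  rw [hC, Subalgebra.mem_centralizer_iff]
  intro g hg
  rw [Set.mem_singleton_iff.1 hg]
  exact (Subalgebra.mem_centralizer_iff ℂ).1 (pullbackOne_mem_centralizer_centralizerAlgebra ψ) _ hφE

end WeilDetOne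

/-! ### §5 The theorem -/

open WeilDetOne

/-- **The Hodge ring of an abelian variety of Weil type whose Hodge group contains `S(A)(ℂ) ∩ SU_K` is generated by
divisor classes and the Weil plane.** Let `dim A = 2n` (`n ≥ 1`), `φ ≫ φ = -d` (`d ≥ 1`) with `φ^*` a
`d`-similitude of `Q_h`, where `h` is a rational class with a Kähler multiple for which `C(A) ⊗ ℂ` is the commutant
of one diagonalisable `φ_E^*` with `Q_h`-adjoint `J'` in the bicommutant (Milne's data: type IV with
`End⁰(A) = E = ℚ(φ_E)` a CM field; then every `ψ^*`, in particular `φ^*`, is central). If every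
`u ∈ S(A)(ℂ) = unitaryCentralizerGroup A h` with `det(u | W) = 1` (`W = ker(φ^* - i√d)`) lies in
`hodgeGroupOne A.dim A.X` («`Hg(A) ⊇ U_E ∩ SU_K`», the GENERAL member of the family; displayed, never discharged),
then `IsDivisorWeilGenerated A φ n d`: every rational `(p,p)`-class lies in `Dᵖ ⊗ ℂ` for `p ≠ n`, and in
`Dⁿ ⊗ ℂ + W_K ⊗ ℂ` for `p = n`. Proof: module docstring (Milne's Lefschetz theorem for the balanced part, the
`K`-torus for the rest). For `E = K` (`n` arbitrary) this is van Geemen's Thm. 6.12 (Weil 1977); for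
`[E:K] = 2, 3` and `n = 3` it is TABLE X rows 11 / 13 («`B• = D• ⊕ W_k`»).
[cite: vanGeemen1994HodgeAV, Thm. 6.12 and its proof] [cite: Milne1999LefschetzClasses, Thm. 3.2 and Cor. 4.5]
[cite: MoonenZarhin1998WeilClasses, §1] [cite: MoonenZarhin1999LowDim, (1.9) and (2.3)] -/
theorem isDivisorWeilGenerated_of_hodgeGroup_ge_unitaryCentralizer_detOne (A : AbelianVariety ℂ) (φ : A ⟶ A)
    {n d : ℕ} (hn : 0 < n) (hA : A.dim = 2 * n) (hd : 0 < d) (hφ : φ ≫ φ = -(d • 𝟙 A))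
    -- Milne's single-generator data for `C(A) ⊗ ℂ`
    (φE : A ⟶ A) (hC : centralizerAlgebra A = Subalgebra.centralizer ℂ {pullbackOne A φE})
    (hdiag : ⨆ μ : ℂ, Module.End.eigenspace (pullbackOne A φE) μ = ⊤)
    {h : complexBetti A.X 2} (hQ : IsRationalClass h)
    (hK : ∃ s : ℝ, 0 < s ∧ IsKaehlerClass A.dim A.X ((s : ℂ) • h))
    (J' : Module.End ℂ (complexBetti A.X 1))
    (hJ' : J' ∈ Subalgebra.centralizer ℂ (centralizerAlgebra A : Set (Module.End ℂ (complexBetti A.X 1))))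
    (hJQ : ∀ x y : complexBetti A.X 1,
      polarizationPairingOne A.X h (A.dim - 1) (pullbackOne A φE x) y =
        polarizationPairingOne A.X h (A.dim - 1) x (J' y))
    -- the `K`-structure: `φ^*` is a `d`-similitude of `Q_h`
    (hφQ : ∀ x y, polarizationPairingOne A.X h (A.dim - 1) (pullbackOne A φ x) (pullbackOne A φ y) =
      (d : ℂ) • polarizationPairingOne A.X h (A.dim - 1) x y)
    -- the general member: `Hg ⊇ S(A)(ℂ) ∩ SU_K`
    (hG : ∀ (u : complexBetti A.X 1 ≃ₗ[ℂ] complexBetti A.X 1) (hu : u ∈ unitaryCentralizerGroup A h),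
      detOnEigenspace u (pullbackOne A φ) (fun x ↦ (mem_centralizerGroup_iff.1 hu.1) φ x)
        (Complex.I * (Real.sqrt d : ℂ)) = 1 → u ∈ hodgeGroupOne A.dim A.X) :
    IsDivisorWeilGenerated A φ n d := by
  classical
  -- `φ^*` is central (`C(A) ⊗ ℂ` is the commutant of one operator)
  have hφC : pullbackOne A φ ∈ centralizerAlgebra A := pullbackOne_mem_centralizerAlgebra_of_singleton φE hC φ
  -- the torus family and the adapted basis
  have hT := fun c : ℂˣ ↦ exists_kTorus (A := A) hd hφ c
  choose T hT₁ hT₂ using hT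
  obtain ⟨B1, hb₁, hb₂⟩ := exists_kBasis (A := A) hd hφ hA
  have h2n : 0 < 2 * n := by omega
  -- the primitive root of unity
  set ζ₀ : ℂ := Complex.exp (2 * Real.pi * Complex.I / (2 * n : ℕ)) with hζ₀
  have hζ : IsPrimitiveRoot ζ₀ (2 * n) := Complex.isPrimitiveRoot_exp (2 * n) (by omega)
  have hζne : ζ₀ ≠ 0 := hζ.ne_zero (by omega)
  set ζ : ℂˣ := Units.mk0 ζ₀ hζne with hζu
  have hζ' : IsPrimitiveRoot (ζ : ℂ) (2 * n) := hζ
  set two : ℂˣ := Units.mk0 (2 : ℂ) two_ne_zero with htwo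
  -- (1) the torus elements lie in `S(A)(ℂ)`, commute with `φ^*`, and have `det = c^{2n}`
  have hTmem : ∀ c : ℂˣ, T c ∈ unitaryCentralizerGroup A h :=
    fun c ↦ kTorus_mem_unitaryCentralizerGroup hd hφ (hT₁ c) (hT₂ c) hφC hφQ
  have hTdet : ∀ c : ℂˣ, detOnEigenspace (T c) (pullbackOne A φ)
      (fun x ↦ (mem_centralizerGroup_iff.1 (hTmem c).1) φ x) (Complex.I * (Real.sqrt d : ℂ)) = (c : ℂ) ^ (2 * n) :=
    fun c ↦ detOnEigenspace_kTorus hd hφ (hT₁ c) hA _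
  -- (2) Hodge classes are fixed by `G = S(A)(ℂ) ∩ SU_K`
  have hfixG : ∀ {p : ℕ} {x : complexBetti A.X (2 * p)}, x ∈ hodgeClassSpan A.dim A.X p →
      ∀ (u : complexBetti A.X 1 ≃ₗ[ℂ] complexBetti A.X 1) (hu : u ∈ unitaryCentralizerGroup A h),
        detOnEigenspace u (pullbackOne A φ) (fun x ↦ (mem_centralizerGroup_iff.1 hu.1) φ x)
          (Complex.I * (Real.sqrt d : ℂ)) = 1 →
        extAct (u : complexBetti A.X 1 →ₗ[ℂ] complexBetti A.X 1) (2 * p) x = x := by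
    intro p x hx u hu hdet
    obtain ⟨g, hg, rfl⟩ := mem_hodgeGroupOne_iff.1 (hG u hu hdet)
    rw [← hodgeGroup_apply_eq_extAct hg]
    exact apply_eq_self_of_mem_hodgeClassSpan hg hx
  -- (3) the torus element `t_ζ` lies in `G`
  have hζdet : detOnEigenspace (T ζ) (pullbackOne A φ)
      (fun x ↦ (mem_centralizerGroup_iff.1 (hTmem ζ).1) φ x) (Complex.I * (Real.sqrt d : ℂ)) = 1 := by
    rw [hTdet ζ]; exact hζ'.pow_eq_one
  -- (4) the main argument in degree `q = 2p`
  have key : ∀ (p : ℕ) (x : complexBetti A.X (2 * p)), x ∈ hodgeClassSpan A.dim A.X p →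
      ∃ x₀ : complexBetti A.X (2 * p), x₀ ∈ divisorClassesSpan A.X A.dim p ∧
        ∀ s : Set.powersetCard (Fin (2 * n + 2 * n)) (2 * p), (monB B1 (2 * p)).repr (x - x₀) s ≠ 0 →
          ((s.val.filter fun j ↦ j.val < 2 * n).card = 2 * n ∧ (s.val.filter fun j ↦ ¬ j.val < 2 * n).card = 0) ∨ ((s.val.filter fun j ↦ j.val < 2 * n).card = 0 ∧ (s.val.filter fun j ↦ ¬ j.val < 2 * n).card = 2 * n) := by
    intro p x hx
    -- the balanced projector
    obtain ⟨P, hP⟩ := exists_balancedProjector (hT₁ two) (hT₂ two) hb₁ hb₂ rfl (2 * p)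
    set L := extAct (T two : complexBetti A.X 1 →ₗ[ℂ] complexBetti A.X 1) (2 * p) with hL
    set x₀ := aeval L P x with hx₀
    -- coordinates of `x₀`
    have hrepr₀ : ∀ s : Set.powersetCard (Fin (2 * n + 2 * n)) (2 * p),
        (monB B1 (2 * p)).repr x₀ s = if (s.val.filter fun j ↦ j.val < 2 * n).card = (s.val.filter fun j ↦ ¬ j.val < 2 * n).card then (monB B1 (2 * p)).repr x s else 0 := by
      intro s
      have hexp : x₀ = ∑ u, (monB B1 (2 * p)).repr x u • aeval L P (monB B1 (2 * p) u) := by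
        conv_lhs => rw [hx₀, ← (monB B1 (2 * p)).sum_repr x, map_sum]
        simp_rw [map_smul]
      rw [hexp, map_sum, Finset.sum_apply']
      simp_rw [map_smul, hP, Finsupp.smul_apply]
      rw [Finset.sum_eq_single s]
      · by_cases hs : (s.val.filter fun j ↦ j.val < 2 * n).card = (s.val.filter fun j ↦ ¬ j.val < 2 * n).card
        · rw [if_pos hs, if_pos hs, Module.Basis.repr_self, Finsupp.single_eq_same, smul_eq_mul, mul_one]
        · rw [if_neg hs, if_neg hs, map_zero, Finsupp.zero_apply, smul_zero]
      · intro u _ hus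
        by_cases hu : (u.val.filter fun j ↦ j.val < 2 * n).card = (u.val.filter fun j ↦ ¬ j.val < 2 * n).card
        · rw [if_pos hu, Module.Basis.repr_self, Finsupp.single_eq_of_ne (Ne.symm hus), smul_zero]
        · rw [if_neg hu, map_zero, Finsupp.zero_apply, smul_zero]
      · intro hs; exact absurd (Finset.mem_univ s) hs
    refine ⟨x₀, ?_, fun s hs ↦ ?_⟩
    · -- `x₀` is `S(A)(ℂ)`-invariant, hence divisorial by Milne
      refine mem_divisorClassesSpan_of_forall_exteriorPullback_eq_of_adjoint φE hC hdiag hQ hK J' hJ' hJQ p x₀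
        fun u hu ↦ ?_
      change extAct (u : complexBetti A.X 1 →ₗ[ℂ] complexBetti A.X 1) (2 * p) x₀ = x₀
      -- factor `u = t_c · g` with `g ∈ G`
      set δ := detOnEigenspace u (pullbackOne A φ) (fun x ↦ (mem_centralizerGroup_iff.1 hu.1) φ x)
        (Complex.I * (Real.sqrt d : ℂ)) with hδ
      obtain ⟨c₁, hc₁⟩ := IsAlgClosed.exists_pow_nat_eq δ h2n
      have hδ0 : δ ≠ 0 := by
        intro h0
        have hui : u⁻¹ ∈ unitaryCentralizerGroup A h := (unitaryCentralizerGroup A h).inv_mem hu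
        have hm := detOnEigenspace_mul (fun x ↦ (mem_centralizerGroup_iff.1 hu.1) φ x)
          (fun x ↦ (mem_centralizerGroup_iff.1 hui.1) φ x)
          (fun x ↦ (mem_centralizerGroup_iff.1 ((unitaryCentralizerGroup A h).mul_mem hu hui).1) φ x)
          (Complex.I * (Real.sqrt d : ℂ))
        rw [← hδ, h0, zero_mul, detOnEigenspace_congr (T := pullbackOne A φ) (mul_inv_cancel u) _ (fun _ ↦ rfl),
          detOnEigenspace_one] at hm
        exact one_ne_zero hm
      have hc₁0 : c₁ ≠ 0 := by rintro rfl; rw [zero_pow h2n.ne'] at hc₁; exact hδ0 hc₁.symm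
      set c : ℂˣ := Units.mk0 c₁ hc₁0 with hc
      set g := T c⁻¹ * u with hg
      have hgmem : g ∈ unitaryCentralizerGroup A h := (unitaryCentralizerGroup A h).mul_mem (hTmem c⁻¹) hu
      have hgdet : detOnEigenspace g (pullbackOne A φ) (fun x ↦ (mem_centralizerGroup_iff.1 hgmem.1) φ x)
          (Complex.I * (Real.sqrt d : ℂ)) = 1 := by
        rw [detOnEigenspace_congr (T := pullbackOne A φ) hg _
            (fun x ↦ (mem_centralizerGroup_iff.1 ((unitaryCentralizerGroup A h).mul_mem (hTmem c⁻¹) hu).1) φ x),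
          detOnEigenspace_mul (fun x ↦ (mem_centralizerGroup_iff.1 (hTmem c⁻¹).1) φ x)
            (fun x ↦ (mem_centralizerGroup_iff.1 hu.1) φ x), hTdet c⁻¹]
        change ((c⁻¹ : ℂˣ) : ℂ) ^ (2 * n) * δ = 1
        rw [← hc₁, Units.val_inv_eq_inv_val, hc, Units.val_mk0, inv_pow]
        exact inv_mul_cancel₀ (pow_ne_zero _ hc₁0)
      -- `⋀g` fixes `x` and commutes with `L`, hence fixes `x₀`
      have hgx : extAct (g : complexBetti A.X 1 →ₗ[ℂ] complexBetti A.X 1) (2 * p) x = x := hfixG hx g hgmem hgdet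
      have hgL : Commute (extAct (g : complexBetti A.X 1 →ₗ[ℂ] complexBetti A.X 1) (2 * p)) L := by
        change extAct (g : complexBetti A.X 1 →ₗ[ℂ] complexBetti A.X 1) (2 * p) * L =
          L * extAct (g : complexBetti A.X 1 →ₗ[ℂ] complexBetti A.X 1) (2 * p)
        rw [hL, Module.End.mul_eq_comp, Module.End.mul_eq_comp, ← extAct_comp, ← extAct_comp]
        congr 1
        refine LinearMap.ext fun v ↦ ?_
        rw [LinearMap.comp_apply, LinearMap.comp_apply, LinearEquiv.coe_coe, LinearEquiv.coe_coe]
        exact kTorus_comm_of_comm hd hφ (hT₁ two) (hT₂ two) (g := (g : complexBetti A.X 1 →ₗ[ℂ] complexBetti A.X 1))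
          (fun x ↦ (mem_centralizerGroup_iff.1 hgmem.1) φ x) v
      have hgx₀ : extAct (g : complexBetti A.X 1 →ₗ[ℂ] complexBetti A.X 1) (2 * p) x₀ = x₀ := by
        rw [hx₀]
        have e := (commute_aeval_of_commute hgL P).eq
        have e' := LinearMap.congr_fun e x
        rw [Module.End.mul_apply, Module.End.mul_apply, hgx] at e'
        exact e'
      -- `⋀t_c` fixes `x₀` (balanced coordinates)
      have htx₀ : extAct (T c : complexBetti A.X 1 →ₗ[ℂ] complexBetti A.X 1) (2 * p) x₀ = x₀ := by
        refine (monB B1 (2 * p)).ext_elem fun s ↦ ?_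
        rw [repr_extAct_kTorus (hT₁ c) (hT₂ c) hb₁ hb₂ (2 * p) x₀ s, hrepr₀ s]
        by_cases hs : (s.val.filter fun j ↦ j.val < 2 * n).card = (s.val.filter fun j ↦ ¬ j.val < 2 * n).card
        · rw [if_pos hs, hs, Units.val_inv_eq_inv_val, inv_pow, mul_inv_cancel₀ (pow_ne_zero _ (Units.ne_zero c)), one_mul]
        · rw [if_neg hs, mul_zero]
      -- assemble: `u = t_c · g`
      have hu_eq : (u : complexBetti A.X 1 →ₗ[ℂ] complexBetti A.X 1) =
          (T c : complexBetti A.X 1 →ₗ[ℂ] complexBetti A.X 1) ∘ₗ (g : complexBetti A.X 1 →ₗ[ℂ] complexBetti A.X 1) := by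
        refine LinearMap.ext fun v ↦ ?_
        have e1 := LinearEquiv.congr_fun
          (kTorus_mul_kTorus_inv hd hφ (hT₁ c) (hT₂ c) (t' := T c⁻¹) (hT₁ c⁻¹) (hT₂ c⁻¹)) (u v)
        change T c (T c⁻¹ (u v)) = u v at e1
        rw [LinearMap.comp_apply, LinearEquiv.coe_coe, LinearEquiv.coe_coe, hg]
        change u v = T c ((T c⁻¹ * u) v)
        rw [LinearEquiv.mul_apply, e1]
      rw [hu_eq, extAct_comp, LinearMap.comp_apply, hgx₀, htx₀]
    · -- the coordinates of `x - x₀` live on the tops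
      have hxζ : extAct (T ζ : complexBetti A.X 1 →ₗ[ℂ] complexBetti A.X 1) (2 * p) x = x :=
        hfixG hx _ (hTmem ζ) hζdet
      have hs' : (monB B1 (2 * p)).repr x s ≠ 0 ∧ ¬ (s.val.filter fun j ↦ j.val < 2 * n).card = (s.val.filter fun j ↦ ¬ j.val < 2 * n).card := by
        rw [map_sub, Finsupp.sub_apply, hrepr₀ s] at hs
        by_cases hbal : (s.val.filter fun j ↦ j.val < 2 * n).card = (s.val.filter fun j ↦ ¬ j.val < 2 * n).card
        · rw [if_pos hbal, sub_self] at hs; exact absurd rfl hs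
        · rw [if_neg hbal, sub_zero] at hs; exact ⟨hs, hbal⟩
      rcases balanced_or_top_of_repr_ne_zero (hT₁ ζ) (hT₂ ζ) hb₁ hb₂ hζ' hxζ hs'.1 with hbal | htop
      · exact absurd hbal hs'.2
      · exact htop
  -- (5) conclusion
  refine ⟨fun p c hpn hcQ hcH ↦ ?_, fun c hcQ hcH ↦ ?_⟩
  · -- off the middle degree: no top index set has `2p` elements
    have hc : c ∈ hodgeClassSpan A.dim A.X p := Submodule.subset_span ⟨hcQ, hcH⟩
    obtain ⟨x₀, hx₀, htop⟩ := key p c hc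
    have hcx : c = x₀ := by
      rw [← sub_eq_zero]
      refine (monB B1 (2 * p)).ext_elem fun s ↦ ?_
      rw [map_zero, Finsupp.zero_apply]
      by_contra hs
      have hcard : (s.val.filter fun j ↦ j.val < 2 * n).card + (s.val.filter fun j ↦ ¬ j.val < 2 * n).card = 2 * p := by rw [card_filter_lt_add, s.prop]
      rcases htop s hs with ⟨ha, hb⟩ | ⟨ha, hb⟩ <;> omega
    rw [hcx]; exact hx₀
  · -- the middle degree: the tops are Weil classes
    have hc : c ∈ hodgeClassSpan A.dim A.X n := Submodule.subset_span ⟨hcQ, hcH⟩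
    obtain ⟨x₀, hx₀, htop⟩ := key n c hc
    have hrest : c - x₀ ∈ weilClassesOf A φ n d := by
      rw [← (monB B1 (2 * n)).sum_repr (c - x₀)]
      refine Submodule.sum_mem _ fun s _ ↦ ?_
      by_cases hs : (monB B1 (2 * n)).repr (c - x₀) s = 0
      · rw [hs, zero_smul]; exact Submodule.zero_mem _
      refine Submodule.smul_mem _ _ ?_
      rcases htop s hs with ⟨-, hb⟩ | ⟨ha, -⟩
      · exact Submodule.mem_sup_left (monB_mem_weilClassesPlus hb₁ s (forall_lt_of_top s.val hb))
      · exact Submodule.mem_sup_right (monB_mem_weilClassesMinus hb₂ s (forall_le_of_top s.val ha))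
    have hc' : c = x₀ + (c - x₀) := by abel
    rw [hc']
    exact Submodule.add_mem_sup hx₀ hrest

end Literature.AlgebraicGeometry.HodgeTheory
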